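import Literature.Probability.Percolation.GrimmettMarstrand1990.SprinklingLemmaLabels
import Summits.CriticalPhenomena.PercolationContinuityZ3.Theorems.PercNearOneGluingNoHeavyQuantThetaDurrettPerimeter
import HarnessLib

/-!
# QUANT lane (p4 gen 22): the total-variation modulus of the LAW OF THE CLUSTER of the origin —
# the coupling inequality `‖Law_p(C) − Law_{p'}(C)‖ ≤ P_p(|C| ≥ n) + (p'−p)·E_p[|∂_E C|; |C| < n]/(1−p)`

builds on p205010 (kernel theorem, internal audit signed; external expert review pending) — NOT used in this file.

METHOD = differential inequalities / regularity of `p ↦` (percolation observables) near `p_c`.  The Margulis–Russo /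
Aizenman–Barsky–Durrett Lipschitz constant `E_p[|∂_E C|; ·]/(1−p)` (Durrett 1985 (5): `θ' ≤ θ·E_p[|∂_E C|; |C|<∞]/(1−p)`,
kernel `ThetaPerimeter.deriv_theta_le_theta_mul_perimeter`) governs not only `θ` but the WHOLE LAW of the cluster `C = C(0)`
of the origin, in total variation, through Grimmett's monotone coupling by i.i.d. uniform labels `U_e` (Grimmett 1999 §1.3
p. 11; tree `labelMeasure`, `configOfLabels`, `map_configOfLabels_holds`).  With `C_π = C_π(U)` the cluster of `0` in the
`π`-open configuration `{e : U_e ≤ π}` and `0 ≤ p ≤ p' ≤ 1`, `p < 1`: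

* §2 `lt_label_of_cl_eq`, `cl_eq_of_boundary_closed`, `exists_boundary_label_le` — if `C_p = S` then every edge of
  `∂_E S` has label `> p`; `C_{p'} ≠ S` forces a boundary edge of `S` with label in `(p, p']`;
* §3–§4 the conditioning step ("given `C_p = S`, the labels of `∂_E S` are i.i.d. uniform on `(p,1]`") done by
  independence of disjoint label sets (`labelMeasure_real_inter_preimage_eq_mul`) for the cluster computed WITHOUT the
  edge `e` (`(zdGraph d).deleteEdges {e}`), which is read off the labels of `edgesTouching S ∖ {e}`:
  **`real_cl_eq_inter_label_le_le`** — `P(C_p = S, U_e ≤ p') ≤ P_p(K = S)·(p'−p)/(1−p)` for `e ∈ ∂_E S`;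
* §5 **`measure_cl_eq_inter_cl_ne_le`** — `P(C_p = S ≠ C_{p'}) ≤ |∂_E S|·P_p(K=S)·(p'−p)/(1−p)`;
* §6 **`measure_cl_ne_le`** (MASTER INEQUALITY, `ℝ≥0∞`) — for every `n`:
  `P(C_p ≠ C_{p'}) ≤ P_p(|C| ≥ n) + (p'−p)/(1−p) · Σ_{|S|<n} |∂_E S| P_p(K = S)`,
  and **`measure_cl_ne_inter_finite_le`** — `P(C_p ≠ C_{p'}, |C_p| < ∞) ≤ (p'−p)/(1−p)·Σ_S |∂_E S| P_p(K=S)`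
  (`= (p'−p)·E_p[|∂_E C|; |C|<∞]/(1−p) ≤ 2d(p'−p)χ^f(p)/(1−p)`, `ThetaPerimeter.perimeter_tsum_le_two_d_mul_chiF`).

Since `sup_𝒜 |P_p(C ∈ 𝒜) − P_{p'}(C ∈ 𝒜)| ≤ P(C_p ≠ C_{p'})`, these are total-variation bounds for the cluster law (the
real-valued TV corollaries, the critical modulus and the oscillation theorem `lim_{p'→p} ‖Law_{p'}(C) − Law_p(C)‖ = θ(p)`
are in the sequel files).  HONEST: elementary (coupling + independence); new as typed; no rate at `p_c`.

## References
* G. Grimmett, *Percolation*, 2nd ed. (1999), §1.3 p. 11 (coupling), §2.4 (Russo/Margulis) [GrimmettPercolation1999].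
* R. Durrett, Z. Wahrsch. verw. Gebiete 69 (1985) 421–437, eq. (5) [Durrett1985].
-/

noncomputable section

namespace Summit.CriticalPhenomena.PercolationContinuityZ3.Theorems.ClusterLaw

open MeasureTheory Literature.Probability.Percolation Literature.Probability.LatticeModels
  Literature.Probability.Percolation.GrimmettMarstrand1990
open scoped ENNReal Classical

variable {d : ℕ}

/-- `Cℓ[π, U]`: the cluster of the origin in the `π`-open configuration of the labels `U` on `ℤ^d`. -/
local notation3 "Cℓ[" π ", " U "]" => openCluster (configOfLabels π U (zdGraph d)) (0 : Site d)

/-- `Cℓ'[π, e, U]`: the same cluster computed with the edge `e` deleted from the lattice. -/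
local notation3 "Cℓ'[" π ", " e ", " U "]" =>
  openCluster (configOfLabels π U ((zdGraph d).deleteEdges {e})) (0 : Site d)

/-- `touch[S, e]`: the labels read by `{C'_π = S}` — the lattice edges touching `S`, except `e`. -/
local notation3 "touch[" S ", " e "]" => (edgesTouching (zdGraph d) S).erase e

/-! ### §1 Monotone coupling: transport of `P_p`-probabilities -/

/-- `C_π ⊆ C_{π'}` for `π ≤ π'` (Grimmett 1999, p. 11: the coupling is monotone). -/
theorem cl_mono (U : Sym2 (Site d) → ℝ) {π π' : ℝ} (h : π ≤ π') : Cℓ[π, U] ⊆ Cℓ[π', U] :=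
  openCluster_mono (configOfLabels_mono U (zdGraph d) h) 0

/-- Transport: the `p`-open configuration of the labels has law `P_p` (`map_configOfLabels_holds`), measure form. -/
theorem labelMeasure_setOf_config_mem (p : unitInterval) {B : Set (BondConfig (Site d))} (hB : MeasurableSet B) :
    labelMeasure (Site d) {U | configOfLabels (p : ℝ) U (zdGraph d) ∈ B} = bondPercolation (zdGraph d) p B := by
  rw [← map_configOfLabels_holds (zdGraph d) p, Measure.map_apply (measurable_configOfLabels (p : ℝ) (zdGraph d)) hB]
  rfl

/-- Transport, real form: `P(η_p ∈ B) = P_p(B)`. -/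
theorem labelMeasure_real_setOf_config_mem (p : unitInterval) {B : Set (BondConfig (Site d))}
    (hB : MeasurableSet B) :
    (labelMeasure (Site d)).real {U | configOfLabels (p : ℝ) U (zdGraph d) ∈ B} =
      (bondPercolation (zdGraph d) p).real B := by
  rw [measureReal_def, measureReal_def, labelMeasure_setOf_config_mem p hB]

/-- `P(C_p = S) = P_p(K_0 = S)`. -/
theorem labelMeasure_real_cl_eq (p : unitInterval) (S : Finset (Site d)) :
    (labelMeasure (Site d)).real {U | Cℓ[(p : ℝ), U] = ↑S} = (bondPercolation (zdGraph d) p).real (clusterIs 0 S) :=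
  labelMeasure_real_setOf_config_mem p (measurableSet_clusterIs 0 S)

/-- The event `{C_π = S}` on the label space is measurable. -/
theorem measurableSet_setOf_cl_eq (π : ℝ) (S : Finset (Site d)) :
    MeasurableSet {U : Sym2 (Site d) → ℝ | Cℓ[π, U] = ↑S} :=
  (measurableSet_clusterIs 0 S).preimage (measurable_configOfLabels π (zdGraph d))

/-! ### §2 Boundary edges of the cluster: closed at level `p`, and the exit edge -/

/-- If `C_π = S` then every edge of the edge boundary `∂_E S` carries a label `> π` (it is `π`-closed). -/
theorem lt_label_of_cl_eq {π : ℝ} {U : Sym2 (Site d) → ℝ} {S : Finset (Site d)} (hS : Cℓ[π, U] = ↑S)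
    {e : Sym2 (Site d)} (he : e ∈ edgeBoundary (zdGraph d) S) : π < U e := by
  by_contra hle
  push Not at hle
  obtain ⟨heE, ⟨x, hxS, hxe⟩, ⟨y, hyS, hye⟩⟩ := mem_edgeBoundary_iff.1 he
  have hxy : x ≠ y := fun h => hyS (h ▸ hxS)
  have hexy : e = s(x, y) := (Sym2.mem_and_mem_iff hxy).1 ⟨hxe, hye⟩
  subst hexy
  have hopen : s(x, y) ∈ configOfLabels π U (zdGraph d) := ⟨heE, hle⟩
  have hcl := (mem_clusterIs_iff.1 (show configOfLabels π U (zdGraph d) ∈ clusterIs 0 S from hS)).2.2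
  exact hyS (hcl x hxS y hopen hxy)

/-- If `C_π = S` and every boundary edge of `S` has label `> π'` (`π ≤ π'`), then `C_{π'} = S` as well. -/
theorem cl_eq_of_boundary_closed {π π' : ℝ} (hππ : π ≤ π') {U : Sym2 (Site d) → ℝ} {S : Finset (Site d)}
    (hS : Cℓ[π, U] = ↑S) (hcl : ∀ e ∈ edgeBoundary (zdGraph d) S, π' < U e) : Cℓ[π', U] = ↑S := by
  have h0 := mem_clusterIs_iff.1 (show configOfLabels π U (zdGraph d) ∈ clusterIs 0 S from hS)
  change configOfLabels π' U (zdGraph d) ∈ clusterIs 0 S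
  refine mem_clusterIs_iff.2 ⟨h0.1, fun y hy => ?_, fun a ha b hab hne => ?_⟩
  · exact isUpperSet_openConnIn _ _ _ (configOfLabels_mono U (zdGraph d) hππ) (h0.2.1 y hy)
  · by_contra hb
    have he : s(a, b) ∈ edgeBoundary (zdGraph d) S :=
      mem_edgeBoundary_iff.2 ⟨hab.1, ⟨a, ha, Sym2.mem_mk_left _ _⟩, ⟨b, hb, Sym2.mem_mk_right _ _⟩⟩
    exact (hcl _ he).not_ge hab.2

/-- **The exit edge**: if `C_π = S` but `C_{π'} ≠ S` (`π ≤ π'`), some boundary edge of `S` has label `≤ π'`. -/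
theorem exists_boundary_label_le {π π' : ℝ} (hππ : π ≤ π') {U : Sym2 (Site d) → ℝ} {S : Finset (Site d)}
    (hS : Cℓ[π, U] = ↑S) (hne : Cℓ[π', U] ≠ ↑S) : ∃ e ∈ edgeBoundary (zdGraph d) S, U e ≤ π' := by
  by_contra h
  push Not at h
  exact hne (cl_eq_of_boundary_closed hππ hS h)

/-! ### §3 The cluster computed without the edge `e` -/

/-- If the label of `e` exceeds `π`, deleting `e` from the lattice does not change the `π`-open configuration. -/
theorem config_deleteEdges_eq {π : ℝ} {U : Sym2 (Site d) → ℝ} {e : Sym2 (Site d)} (he : π < U e) :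
    configOfLabels π U ((zdGraph d).deleteEdges {e}) = configOfLabels π U (zdGraph d) := by
  ext f
  simp only [configOfLabels, Set.mem_setOf_eq, SimpleGraph.edgeSet_deleteEdges, Set.mem_sdiff,
    Set.mem_singleton_iff]
  constructor
  · rintro ⟨⟨hf, -⟩, hle⟩
    exact ⟨hf, hle⟩
  · rintro ⟨hf, hle⟩
    refine ⟨⟨hf, ?_⟩, hle⟩
    rintro rfl
    exact he.not_ge hle

/-- `{C_π = S} ⊆ {C'_π = S}` for a boundary edge `e` of `S` (its label is `> π` on `{C_π = S}`). -/
theorem setOf_cl_eq_subset_clE (π : ℝ) (S : Finset (Site d)) {e : Sym2 (Site d)}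
    (he : e ∈ edgeBoundary (zdGraph d) S) :
    {U : Sym2 (Site d) → ℝ | Cℓ[π, U] = ↑S} ⊆ {U | Cℓ'[π, e, U] = ↑S} := by
  intro U hU
  have hlt := lt_label_of_cl_eq hU he
  change openCluster (configOfLabels π U ((zdGraph d).deleteEdges {e})) 0 = ↑S
  rw [config_deleteEdges_eq hlt]
  exact hU

/-- `{C'_π = S} ∩ {U_e > π} ⊆ {C_π = S}`. -/
theorem setOf_clE_eq_inter_subset (π : ℝ) (S : Finset (Site d)) (e : Sym2 (Site d)) :
    {U : Sym2 (Site d) → ℝ | Cℓ'[π, e, U] = ↑S} ∩ {U | π < U e} ⊆ {U | Cℓ[π, U] = ↑S} := by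
  rintro U ⟨hU, hlt⟩
  change openCluster (configOfLabels π U (zdGraph d)) 0 = ↑S
  rw [← config_deleteEdges_eq hlt]
  exact hU

/-- **`{C'_π = S}` is read off the labels of `edgesTouching S ∖ {e}`**: it is the preimage, under restriction of the
labels, of a measurable set (the determination `determinedBy_clusterIs` of `{K_0 = S}` by the edges touching `S`). -/
theorem setOf_clE_eq_eq_preimage (π : ℝ) (S : Finset (Site d)) (e : Sym2 (Site d)) :
    {U : Sym2 (Site d) → ℝ | Cℓ'[π, e, U] = ↑S} =
      (fun (U : Sym2 (Site d) → ℝ) (f : ↥(touch[S, e])) => U f) ⁻¹'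
        {v | openCluster (configOfLabels π (extendLabels (touch[S, e]) v) ((zdGraph d).deleteEdges {e})) 0 = ↑S} := by
  ext U
  simp only [Set.mem_setOf_eq, Set.mem_preimage]
  have key : configOfLabels π (extendLabels (touch[S, e]) fun f : ↥(touch[S, e]) => U f)
        ((zdGraph d).deleteEdges {e}) ∩ Literature.Probability.Percolation.edgesTouching (↑S : Set (Site d)) =
      configOfLabels π U ((zdGraph d).deleteEdges {e}) ∩
        Literature.Probability.Percolation.edgesTouching (↑S : Set (Site d)) := by
    ext f
    simp only [Set.mem_inter_iff, configOfLabels, Set.mem_setOf_eq, SimpleGraph.edgeSet_deleteEdges,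
      Set.mem_sdiff, Set.mem_singleton_iff]
    constructor
    · rintro ⟨⟨⟨hf, hfe⟩, hle⟩, ht⟩
      obtain ⟨v, hvf, hvS⟩ := ht
      have hmem : f ∈ touch[S, e] :=
        Finset.mem_erase.2 ⟨hfe, mem_edgesTouching_iff.2 ⟨hf, v, hvS, hvf⟩⟩
      rw [extendLabels_apply_of_mem _ U hmem] at hle
      exact ⟨⟨⟨hf, hfe⟩, hle⟩, v, hvf, hvS⟩
    · rintro ⟨⟨⟨hf, hfe⟩, hle⟩, ht⟩
      obtain ⟨v, hvf, hvS⟩ := ht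
      have hmem : f ∈ touch[S, e] :=
        Finset.mem_erase.2 ⟨hfe, mem_edgesTouching_iff.2 ⟨hf, v, hvS, hvf⟩⟩
      refine ⟨⟨⟨hf, hfe⟩, ?_⟩, v, hvf, hvS⟩
      rw [extendLabels_apply_of_mem _ U hmem]
      exact hle
  have h := (determinedBy_iff _ _).1 (determinedBy_clusterIs (0 : Site d) S) _ _ key
  exact h.symm

/-- The set on the right of `setOf_clE_eq_eq_preimage` is measurable. -/
theorem measurableSet_clE_fibre (π : ℝ) (S : Finset (Site d)) (e : Sym2 (Site d)) :
    MeasurableSet {v : ↥(touch[S, e]) → ℝ |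
      openCluster (configOfLabels π (extendLabels (touch[S, e]) v) ((zdGraph d).deleteEdges {e})) 0 = ↑S} :=
  (measurableSet_clusterIs 0 S).preimage
    ((measurable_configOfLabels π ((zdGraph d).deleteEdges {e})).comp (measurable_extendLabels (touch[S, e])))

/-- `{C'_π = S}` is measurable. -/
theorem measurableSet_setOf_clE_eq (π : ℝ) (S : Finset (Site d)) (e : Sym2 (Site d)) :
    MeasurableSet {U : Sym2 (Site d) → ℝ | Cℓ'[π, e, U] = ↑S} :=
  (measurableSet_clusterIs 0 S).preimage (measurable_configOfLabels π ((zdGraph d).deleteEdges {e}))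

/-! ### §4 Independence of `{C'_π = S}` from the label of `e` -/

/-- A one-label event as a preimage under restriction to `{e}`. -/
theorem setOf_label_mem_eq_preimage (e : Sym2 (Site d)) (I : Set ℝ) :
    {U : Sym2 (Site d) → ℝ | U e ∈ I} =
      (fun (U : Sym2 (Site d) → ℝ) (f : ↥({e} : Finset (Sym2 (Site d)))) => U f) ⁻¹'
        {v | v ⟨e, Finset.mem_singleton_self e⟩ ∈ I} := by
  ext U; simp

/-- The law of one label: `P(U_e ∈ I) = Leb_{[0,1]}(I)`. -/
theorem labelMeasure_real_label_mem (e : Sym2 (Site d)) {I : Set ℝ} (hI : MeasurableSet I) :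
    (labelMeasure (Site d)).real {U | U e ∈ I} = ((volume : Measure ℝ).restrict (Set.Icc (0 : ℝ) 1)).real I := by
  have h : {U : Sym2 (Site d) → ℝ | U e ∈ I} = Set.pi ↑({e} : Finset (Sym2 (Site d))) fun _ => I := by
    ext U; simp
  rw [h, labelMeasure_real_pi {e} fun _ _ => hI, Finset.prod_singleton]

/-- **Independence**: `P(C'_π = S, U_e ∈ I) = P(C'_π = S) · Leb_{[0,1]}(I)` — the event `{C'_π = S}` reads the labels
of `edgesTouching S ∖ {e}`, which exclude `e`. -/
theorem real_clE_eq_inter_label_mem (π : ℝ) (S : Finset (Site d)) (e : Sym2 (Site d)) {I : Set ℝ}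
    (hI : MeasurableSet I) :
    (labelMeasure (Site d)).real ({U | Cℓ'[π, e, U] = ↑S} ∩ {U | U e ∈ I}) =
      (labelMeasure (Site d)).real {U | Cℓ'[π, e, U] = ↑S} *
        ((volume : Measure ℝ).restrict (Set.Icc (0 : ℝ) 1)).real I := by
  have hdisj : Disjoint (touch[S, e]) ({e} : Finset (Sym2 (Site d))) :=
    Finset.disjoint_singleton_right.2 (Finset.notMem_erase e _)
  have hse : MeasurableSet {v : ↥({e} : Finset (Sym2 (Site d))) → ℝ | v ⟨e, Finset.mem_singleton_self e⟩ ∈ I} :=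
    measurable_pi_apply _ hI
  rw [← labelMeasure_real_label_mem e hI, setOf_clE_eq_eq_preimage, setOf_label_mem_eq_preimage,
    labelMeasure_real_inter_preimage_eq_mul hdisj (measurableSet_clE_fibre π S e) hse]

/-- `Leb_{[0,1]}((p, p']) = p' − p` for `0 ≤ p ≤ p' ≤ 1`. -/
theorem volume_restrict_real_Ioc {p p' : ℝ} (hp : 0 ≤ p) (hpp : p ≤ p') (hp' : p' ≤ 1) :
    ((volume : Measure ℝ).restrict (Set.Icc (0 : ℝ) 1)).real (Set.Ioc p p') = p' - p := by
  rw [measureReal_def, Measure.restrict_apply measurableSet_Ioc]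
  have : Set.Ioc p p' ∩ Set.Icc (0 : ℝ) 1 = Set.Ioc p p' := by
    ext x
    simp only [Set.mem_inter_iff, Set.mem_Ioc, Set.mem_Icc]
    constructor
    · rintro ⟨⟨h1, h2⟩, -⟩; exact ⟨h1, h2⟩
    · rintro ⟨h1, h2⟩; exact ⟨⟨h1, h2⟩, (hp.trans h1.le), h2.trans hp'⟩
  rw [this, Real.volume_Ioc, ENNReal.toReal_ofReal (by linarith)]

/-- **The conditioning step**: for a boundary edge `e` of `S` and `0 ≤ p ≤ p' ≤ 1`, `p < 1`,
`P(C_p = S, U_e ≤ p') ≤ P_p(K_0 = S) · (p' − p)/(1 − p)`. -/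
theorem real_cl_eq_inter_label_le_le {p p' : ℝ} (hp0 : 0 ≤ p) (hpp : p ≤ p') (hp'1 : p' ≤ 1) (hp1 : p < 1)
    (S : Finset (Site d)) {e : Sym2 (Site d)} (he : e ∈ edgeBoundary (zdGraph d) S) :
    (labelMeasure (Site d)).real ({U | Cℓ[p, U] = ↑S} ∩ {U | U e ≤ p'}) ≤
      (labelMeasure (Site d)).real {U | Cℓ[p, U] = ↑S} * ((p' - p) / (1 - p)) := by
  have := isProbabilityMeasure_labelMeasure (Site d)
  set E : Set (Sym2 (Site d) → ℝ) := {U | Cℓ'[p, e, U] = ↑S} with hE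
  -- `{C_p = S, U_e ≤ p'} ⊆ E ∩ {U_e ∈ (p, p']}`
  have h1 : {U | Cℓ[p, U] = ↑S} ∩ {U | U e ≤ p'} ⊆ E ∩ {U | U e ∈ Set.Ioc p p'} := by
    rintro U ⟨hU, hle⟩
    exact ⟨setOf_cl_eq_subset_clE p S he hU, lt_label_of_cl_eq hU he, hle⟩
  -- `E ∩ {U_e > p} ⊆ {C_p = S}`
  have h2 : E ∩ {U | U e ∈ Set.Ioi p} ⊆ {U | Cℓ[p, U] = ↑S} := setOf_clE_eq_inter_subset p S e
  have hm1 : (labelMeasure (Site d)).real (E ∩ {U | U e ∈ Set.Ioc p p'}) =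
      (labelMeasure (Site d)).real E * (p' - p) := by
    rw [hE, real_clE_eq_inter_label_mem p S e measurableSet_Ioc, volume_restrict_real_Ioc hp0 hpp hp'1]
  have hm2 : (labelMeasure (Site d)).real (E ∩ {U | U e ∈ Set.Ioi p}) =
      (labelMeasure (Site d)).real E * (1 - p) := by
    rw [hE, real_clE_eq_inter_label_mem p S e measurableSet_Ioi, volume_restrict_unitInterval_real_Ioi hp0,
      max_eq_left (by linarith)]
  have hEle : (labelMeasure (Site d)).real E * (1 - p) ≤ (labelMeasure (Site d)).real {U | Cℓ[p, U] = ↑S} := by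
    rw [← hm2]; exact measureReal_mono h2 (measure_ne_top _ _)
  have h1p : (1 : ℝ) - p ≠ 0 := (sub_pos.2 hp1).ne'
  have hc : 0 ≤ (p' - p) / (1 - p) := div_nonneg (by linarith) (by linarith)
  calc (labelMeasure (Site d)).real ({U | Cℓ[p, U] = ↑S} ∩ {U | U e ≤ p'})
      ≤ (labelMeasure (Site d)).real (E ∩ {U | U e ∈ Set.Ioc p p'}) := measureReal_mono h1 (measure_ne_top _ _)
    _ = (labelMeasure (Site d)).real E * (1 - p) * ((p' - p) / (1 - p)) := by
        rw [hm1]; field_simp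
    _ ≤ (labelMeasure (Site d)).real {U | Cℓ[p, U] = ↑S} * ((p' - p) / (1 - p)) :=
        mul_le_mul_of_nonneg_right hEle hc

/-! ### §5 Per animal: `P(C_p = S ≠ C_{p'}) ≤ |∂_E S| · P_p(K = S) · (p'−p)/(1−p)` -/

/-- **Per-animal coupling bound** (real form). -/
theorem real_cl_eq_inter_cl_ne_le {p p' : ℝ} (hp0 : 0 ≤ p) (hpp : p ≤ p') (hp'1 : p' ≤ 1) (hp1 : p < 1)
    (S : Finset (Site d)) :
    (labelMeasure (Site d)).real ({U | Cℓ[p, U] = ↑S} ∩ {U | Cℓ[p', U] ≠ ↑S}) ≤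
      (edgeBoundary (zdGraph d) S).card * (labelMeasure (Site d)).real {U | Cℓ[p, U] = ↑S} *
        ((p' - p) / (1 - p)) := by
  have := isProbabilityMeasure_labelMeasure (Site d)
  have hsub : {U | Cℓ[p, U] = ↑S} ∩ {U | Cℓ[p', U] ≠ ↑S} ⊆
      ⋃ e ∈ edgeBoundary (zdGraph d) S, ({U | Cℓ[p, U] = ↑S} ∩ {U | U e ≤ p'}) := by
    rintro U ⟨hU, hne⟩
    obtain ⟨e, he, hle⟩ := exists_boundary_label_le hpp hU hne
    exact Set.mem_biUnion he ⟨hU, hle⟩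
  calc (labelMeasure (Site d)).real ({U | Cℓ[p, U] = ↑S} ∩ {U | Cℓ[p', U] ≠ ↑S})
      ≤ (labelMeasure (Site d)).real (⋃ e ∈ edgeBoundary (zdGraph d) S, ({U | Cℓ[p, U] = ↑S} ∩ {U | U e ≤ p'})) :=
        measureReal_mono hsub (measure_ne_top _ _)
    _ ≤ ∑ e ∈ edgeBoundary (zdGraph d) S, (labelMeasure (Site d)).real ({U | Cℓ[p, U] = ↑S} ∩ {U | U e ≤ p'}) :=
        measureReal_biUnion_finset_le _ _
    _ ≤ ∑ _e ∈ edgeBoundary (zdGraph d) S, (labelMeasure (Site d)).real {U | Cℓ[p, U] = ↑S} * ((p' - p) / (1 - p)) :=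
        Finset.sum_le_sum fun e he => real_cl_eq_inter_label_le_le hp0 hpp hp'1 hp1 S he
    _ = _ := by rw [Finset.sum_const, nsmul_eq_mul, mul_assoc]

/-- **Per-animal coupling bound**, measure form with `P_p(K_0 = S)`:
`P(C_p = S ≠ C_{p'}) ≤ ofReal((p'−p)/(1−p)) · |∂_E S| · P_p(K_0 = S)`. -/
theorem measure_cl_eq_inter_cl_ne_le (p p' : unitInterval) (hpp : p ≤ p') (hp1 : (p : ℝ) < 1)
    (S : Finset (Site d)) :
    labelMeasure (Site d) ({U | Cℓ[(p : ℝ), U] = ↑S} ∩ {U | Cℓ[(p' : ℝ), U] ≠ ↑S}) ≤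
      ENNReal.ofReal (((p' : ℝ) - p) / (1 - p)) *
        (((edgeBoundary (zdGraph d) S).card : ℝ≥0∞) * bondPercolation (zdGraph d) p (clusterIs 0 S)) := by
  have := isProbabilityMeasure_labelMeasure (Site d)
  have h := real_cl_eq_inter_cl_ne_le (d := d) p.2.1 (show (p : ℝ) ≤ p' from hpp) p'.2.2 hp1 S
  rw [labelMeasure_real_cl_eq p S] at h
  have hc : 0 ≤ ((p' : ℝ) - p) / (1 - p) := div_nonneg (by exact sub_nonneg.2 (show (p:ℝ) ≤ p' from hpp)) (by linarith)
  rw [← ENNReal.ofReal_toReal (measure_ne_top (labelMeasure (Site d)) _),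
    ← ENNReal.ofReal_toReal (measure_ne_top (bondPercolation (zdGraph d) p) (clusterIs 0 S)),
    ← ENNReal.ofReal_natCast, ← ENNReal.ofReal_mul (Nat.cast_nonneg _), ← ENNReal.ofReal_mul hc]
  refine ENNReal.ofReal_le_ofReal ?_
  rw [← measureReal_def, ← measureReal_def]
  linarith [h]

/-! ### §6 The master inequality -/

/-- `{C_p ≠ C_{p'}} ∩ {|C_p| < ∞} ⊆ ⋃_S {C_p = S ≠ C_{p'}}`. -/
theorem setOf_cl_ne_inter_finite_subset (π π' : ℝ) :
    {U : Sym2 (Site d) → ℝ | Cℓ[π, U] ≠ Cℓ[π', U]} ∩ {U | (Cℓ[π, U]).Finite} ⊆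
      ⋃ S : Finset (Site d), ({U | Cℓ[π, U] = ↑S} ∩ {U | Cℓ[π', U] ≠ ↑S}) := by
  rintro U ⟨hne, hfin⟩
  refine Set.mem_iUnion.2 ⟨hfin.toFinset, ?_, ?_⟩
  · simp
  · simpa using fun h => hne h.symm

/-- **MASTER INEQUALITY, finite-cluster form**: for `0 ≤ p ≤ p' ≤ 1`, `p < 1`,
`P(C_p ≠ C_{p'}, |C_p| < ∞) ≤ (p'−p)/(1−p) · Σ_S |∂_E S|·P_p(K_0 = S)` (`= (p'−p)·E_p[|∂_E C|; |C|<∞]/(1−p)`). -/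
theorem measure_cl_ne_inter_finite_le (p p' : unitInterval) (hpp : p ≤ p') (hp1 : (p : ℝ) < 1) :
    labelMeasure (Site d) ({U | Cℓ[(p : ℝ), U] ≠ Cℓ[(p' : ℝ), U]} ∩ {U | (Cℓ[(p : ℝ), U]).Finite}) ≤
      ENNReal.ofReal (((p' : ℝ) - p) / (1 - p)) *
        ∑' S : Finset (Site d), ((edgeBoundary (zdGraph d) S).card : ℝ≥0∞) *
          bondPercolation (zdGraph d) p (clusterIs 0 S) := by
  calc labelMeasure (Site d) ({U | Cℓ[(p : ℝ), U] ≠ Cℓ[(p' : ℝ), U]} ∩ {U | (Cℓ[(p : ℝ), U]).Finite})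
      ≤ labelMeasure (Site d) (⋃ S : Finset (Site d), ({U | Cℓ[(p : ℝ), U] = ↑S} ∩ {U | Cℓ[(p' : ℝ), U] ≠ ↑S})) :=
        measure_mono (setOf_cl_ne_inter_finite_subset _ _)
    _ ≤ ∑' S : Finset (Site d), labelMeasure (Site d) ({U | Cℓ[(p : ℝ), U] = ↑S} ∩ {U | Cℓ[(p' : ℝ), U] ≠ ↑S}) :=
        measure_iUnion_le _
    _ ≤ ∑' S : Finset (Site d), ENNReal.ofReal (((p' : ℝ) - p) / (1 - p)) *
          (((edgeBoundary (zdGraph d) S).card : ℝ≥0∞) * bondPercolation (zdGraph d) p (clusterIs 0 S)) :=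
        ENNReal.tsum_le_tsum fun S => measure_cl_eq_inter_cl_ne_le p p' hpp hp1 S
    _ = _ := ENNReal.tsum_mul_left

/-- `{C_p ≠ C_{p'}} ⊆ {|C_p| ≥ n} ∪ ⋃_{|S| < n} {C_p = S ≠ C_{p'}}`. -/
theorem setOf_cl_ne_subset (π π' : ℝ) (n : ℕ) :
    {U : Sym2 (Site d) → ℝ | Cℓ[π, U] ≠ Cℓ[π', U]} ⊆
      {U | configOfLabels π U (zdGraph d) ∈ clusterSizeGe (0 : Site d) n} ∪
        ⋃ S : Finset (Site d), ({_U | S.card < n} ∩ ({U | Cℓ[π, U] = ↑S} ∩ {U | Cℓ[π', U] ≠ ↑S})) := by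
  intro U hne
  by_cases hn : (n : ℕ∞) ≤ (Cℓ[π, U]).encard
  · exact Or.inl hn
  · right
    push Not at hn
    have hfin : (Cℓ[π, U]).Finite := Set.encard_lt_top_iff.1 (hn.trans_le le_top)
    refine Set.mem_iUnion.2 ⟨hfin.toFinset, ?_, ?_, ?_⟩
    · change hfin.toFinset.card < n
      have h1 : (hfin.toFinset.card : ℕ∞) = (Cℓ[π, U]).encard := by
        rw [← Set.encard_coe_eq_coe_finsetCard, Set.Finite.coe_toFinset]
      exact_mod_cast (h1 ▸ hn : (hfin.toFinset.card : ℕ∞) < n)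
    · simp
    · simpa using fun h => hne h.symm

/-- **MASTER INEQUALITY (the coupling modulus of the cluster law)**: for `0 ≤ p ≤ p' ≤ 1`, `p < 1` and every `n`,
`P(C_p ≠ C_{p'}) ≤ P_p(|C| ≥ n) + (p'−p)/(1−p) · Σ_{|S| < n} |∂_E S|·P_p(K_0 = S)`. -/
theorem measure_cl_ne_le (p p' : unitInterval) (hpp : p ≤ p') (hp1 : (p : ℝ) < 1) (n : ℕ) :
    labelMeasure (Site d) {U | Cℓ[(p : ℝ), U] ≠ Cℓ[(p' : ℝ), U]} ≤
      bondPercolation (zdGraph d) p (clusterSizeGe (0 : Site d) n) +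
        ENNReal.ofReal (((p' : ℝ) - p) / (1 - p)) *
          ∑' S : Finset (Site d), (if S.card < n then
            ((edgeBoundary (zdGraph d) S).card : ℝ≥0∞) * bondPercolation (zdGraph d) p (clusterIs 0 S) else 0) := by
  have hA : labelMeasure (Site d) {U | configOfLabels (p : ℝ) U (zdGraph d) ∈ clusterSizeGe (0 : Site d) n} =
      bondPercolation (zdGraph d) p (clusterSizeGe (0 : Site d) n) :=
    labelMeasure_setOf_config_mem p (measurableSet_clusterSizeGe 0 n)
  calc labelMeasure (Site d) {U | Cℓ[(p : ℝ), U] ≠ Cℓ[(p' : ℝ), U]}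
      ≤ labelMeasure (Site d) ({U | configOfLabels (p : ℝ) U (zdGraph d) ∈ clusterSizeGe (0 : Site d) n} ∪
          ⋃ S : Finset (Site d), ({_U | S.card < n} ∩
            ({U | Cℓ[(p : ℝ), U] = ↑S} ∩ {U | Cℓ[(p' : ℝ), U] ≠ ↑S}))) := measure_mono (setOf_cl_ne_subset _ _ n)
    _ ≤ labelMeasure (Site d) {U | configOfLabels (p : ℝ) U (zdGraph d) ∈ clusterSizeGe (0 : Site d) n} +
          labelMeasure (Site d) (⋃ S : Finset (Site d), ({_U | S.card < n} ∩
            ({U | Cℓ[(p : ℝ), U] = ↑S} ∩ {U | Cℓ[(p' : ℝ), U] ≠ ↑S}))) := measure_union_le _ _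
    _ ≤ bondPercolation (zdGraph d) p (clusterSizeGe (0 : Site d) n) +
          ∑' S : Finset (Site d), labelMeasure (Site d) ({_U | S.card < n} ∩
            ({U | Cℓ[(p : ℝ), U] = ↑S} ∩ {U | Cℓ[(p' : ℝ), U] ≠ ↑S})) := by
        rw [hA]; gcongr; exact measure_iUnion_le _
    _ ≤ bondPercolation (zdGraph d) p (clusterSizeGe (0 : Site d) n) +
          ∑' S : Finset (Site d), ENNReal.ofReal (((p' : ℝ) - p) / (1 - p)) * (if S.card < n then
            ((edgeBoundary (zdGraph d) S).card : ℝ≥0∞) * bondPercolation (zdGraph d) p (clusterIs 0 S) else 0) := by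
        gcongr with S
        by_cases hS : S.card < n
        · rw [if_pos hS, show ({_U : Sym2 (Site d) → ℝ | S.card < n}) = Set.univ from Set.eq_univ_of_forall fun _ => hS,
            Set.univ_inter]
          exact measure_cl_eq_inter_cl_ne_le p p' hpp hp1 S
        · rw [if_neg hS, show ({_U : Sym2 (Site d) → ℝ | S.card < n}) = ∅ from Set.eq_empty_of_forall_notMem fun _ => hS,
            Set.empty_inter, measure_empty, mul_zero]
    _ = _ := by rw [ENNReal.tsum_mul_left]

end Summit.CriticalPhenomena.PercolationContinuityZ3.Theorems.ClusterLaw
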